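import Summits.AtomisticToContinuum.HydrodynamicLimit.Theorems.LambertianContactSwapLambertianEulerWindowEntropyInequality
import HarnessLib

/-!
# The fresh-tail (strong Markov) identity IN LAW of the Lambertian gas for general functionals, and the entropy
# inequality with restart (tool `RestartInLaw` of line `Sketch`, crux stmt-AtomisticToContinuum-11854, lead c8)

Support file (`--supports stmt-AtomisticToContinuum-11854`).  For the Lambertian hard-sphere flow
`Λ_s(z; ξs) = lambertFlow G ε ξs z s` of `Literature.MathematicalPhysics.KineticTheory.LambertianHardSphereFlow` on
`𝕋³` (`N + 1` spheres of diameter `ε = hsDiameter σ N`, `0 < σ < 1/2`), driven by the i.i.d. Gaussian redraws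
`ξs ∼ γ^ℕ = lambertNoise`, write `K_s = lambertCount` for the number of redraws consumed in `[0, s]` and
`restart_s(z, ξs) := (Λ_s(z; ξs), ξs (· + K_s(z; ξs)))` for the pair (state at time `s`, unconsumed noise).  For an
initial law `P ≪ liouville` let `μ_s := (P ⊗ γ^ℕ) ∘ Λ_s⁻¹` be the law of `Λ_s`.  This file proves:

* `lintegral_restart_eq` (R1): `∫ H ∘ restart_s d(P ⊗ γ^ℕ) = ∫ H d(μ_s ⊗ γ^ℕ)` for EVERY measurable `H ≥ 0` on
  (state, noise) — the noise not yet consumed at time `s` is a fresh `γ^ℕ` sequence independent of the state `Λ_s`;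
* `map_lambertRestart_eq`: equivalently, the LAW of `restart_s` under `P ⊗ γ^ℕ` is `μ_s ⊗ γ^ℕ`;
* `integral_restart_eq` (R2): the same identity for the Bochner integral of every measurable real `H` (no
  boundedness or integrability is needed: `integral_map` along the law identity), and `integrable_restart`:
  `H ∘ restart_s` is `P ⊗ γ^ℕ`-integrable for bounded measurable `H` and finite `P`;
* `restart_entropyInequality` (R3): for probability laws `P ≪ liouville` and `R`, a bounded measurable `H`, a rate
  `β > 0` and `KL(μ_s ‖ R) < ∞`,
  `−E_{P⊗γ^ℕ}[H ∘ restart_s] ≤ β⁻¹ (KL(μ_s ‖ R) + log E_{R⊗γ^ℕ}[e^{−βH}])`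
  (R2, then the entropy inequality across the shared noise factor
  `…LambertianEulerRestartEntropyInequality.integral_prod_noise_ge`, exactly as assembled for time-integral window
  functionals in `…LambertianEulerWindowEntropyInequality.window_entropyInequality_restart`).

The landed `…LambertianEulerWindowRestart.integral_window_restart` (time-integral functionals) and
`…LambertianEulerTwoTimeLaw.lintegral_twoTime_eq` (two-time observables) are the special cases used by the kinetic
heart; the collisional heart restarts windowed JUMP functionals `Σ_{m<K_b} 1{a < t_{m+1}} J(t_{m+1}, z_m)`, which
pathwise are `H ∘ restart_a` for a bounded measurable `H` (the window cocycle, a separate tool), whence the general `H`.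
Proof of R1 (the calc block of `…LambertianEulerLiouvilleOfWindow.map_lambertFlow_add_eq` /
`…LambertianEulerTwoTimeLaw.lintegral_twoTime_eq` with a general `H`, first for any geometry and any initial measure,
`lintegral_restart_eq_of_freshTail`): Tonelli over `P` then `γ^ℕ`; for `P`-a.e. `z` the collision instants of `(z, ·)`
`γ^ℕ`-a.s. pass beyond `s` (`…SwapGapLiouvilleInvarianceLambda.nonAccumulationLambda` transported along
`P ≪ liouville`), so the pathwise fresh-tail identity `…LambertianEulerFreshTail.lambertFlow_freshTail` rewrites the
inner integral as `∫ dγ^ℕ(ξs) ∫ dγ^ℕ(ηs) H(Λ_s(z;ξs), ηs)`; undo Tonelli, `lintegral_map`, Tonelli.  All [folklore]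
(the strong Markov property of i.i.d. redraws read at a stopping index; the entropy inequality is Kipnis–Landim 1999,
Appendix 1 §8, already landed).
-/

noncomputable section

namespace Summit.AtomisticToContinuum.HydrodynamicLimit.Theorems.LambertianContactSwapLambertianEulerRestartInLaw

open scoped BigOperators Topology ENNReal
open MeasureTheory ProbabilityTheory Filter Set InformationTheory
open Literature.MathematicalPhysics.KineticTheory
open Literature.Analysis.FluidPDE Literature.Analysis.FluidPDE.Alexander
open Summit.AtomisticToContinuum.HydrodynamicLimit.Theorems.LambertianContactSwapLambertianEulerFreshTail
open Summit.AtomisticToContinuum.HydrodynamicLimit.Theorems.LambertianContactSwapSwapGapLiouvilleInvarianceLambda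
open Summit.AtomisticToContinuum.HydrodynamicLimit.Theorems.LambertianContactSwapLambertianEulerRestartEntropyInequality

/-! ## The identity in law, any geometry and any initial measure -/

section Step

variable {d : Type*} [Fintype d] {X : Type*} [MeasurableSpace X] {N : ℕ} {G : Geometry d X} {ε : ℝ}

/-- **Fresh-tail identity in law under an initial measure** (any geometry, any initial measure `L` on phase
space): granted joint measurability of `Λ_s` and of `K_s` in `(z, ξs)`, that `L ⊗ γ^ℕ`-a.e. some collision instant
passes beyond `s ≥ 0`, and the pathwise fresh-tail identity (for a fixed datum `z`, the noise shifted by `K_s` is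
again `γ^ℕ`-distributed and independent of `Λ_s(z; ·)`, in `lintegral` form), for every measurable `H ≥ 0` on
(state, noise): `∫ H(Λ_s, ξs (· + K_s)) d(L ⊗ γ^ℕ) = ∫ H d(((L ⊗ γ^ℕ) ∘ Λ_s⁻¹) ⊗ γ^ℕ)`. [folklore] -/
theorem lintegral_restart_eq_of_freshTail (L : Measure (Config N d X)) {s : ℝ} (hs : 0 ≤ s)
    (hmeas : Measurable fun p : Config N d X × (ℕ → EuclideanSpace ℝ d) => lambertFlow G ε p.2 p.1 s)
    (hK : Measurable fun p : Config N d X × (ℕ → EuclideanSpace ℝ d) => lambertCount G ε p.2 p.1 s)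
    (hacc : ∀ᵐ p ∂(L.prod (lambertNoise d)), ∃ k, ENNReal.ofReal s < lambertInstant G ε p.2 p.1 k)
    (hfresh : ∀ {H : Config N d X × (ℕ → EuclideanSpace ℝ d) → ℝ≥0∞}, Measurable H →
      ∀ (z : Config N d X) (t : ℝ), 0 ≤ t →
        (∀ᵐ ξs ∂(lambertNoise d), ∃ k, ENNReal.ofReal t < lambertInstant G ε ξs z k) →
        ∫⁻ ξs, H (lambertFlow G ε ξs z t, fun n => ξs (n + lambertCount G ε ξs z t))
            ∂(lambertNoise d) =
          ∫⁻ ξs, (∫⁻ ηs, H (lambertFlow G ε ξs z t, ηs) ∂(lambertNoise d)) ∂(lambertNoise d))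
    {H : Config N d X × (ℕ → EuclideanSpace ℝ d) → ℝ≥0∞} (hH : Measurable H) :
    ∫⁻ p, H (lambertFlow G ε p.2 p.1 s, fun n => p.2 (n + lambertCount G ε p.2 p.1 s))
        ∂(L.prod (lambertNoise d)) =
      ∫⁻ q, H q ∂(((L.prod (lambertNoise d)).map (fun p => lambertFlow G ε p.2 p.1 s)).prod
        (lambertNoise d)) := by
  have hR : Measurable fun p : Config N d X × (ℕ → EuclideanSpace ℝ d) =>
      H (lambertFlow G ε p.2 p.1 s, fun n => p.2 (n + lambertCount G ε p.2 p.1 s)) :=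
    hH.comp (hmeas.prodMk
      (LambertianContactSwapLambertianEulerMarkov.measurable_shiftBy d hK measurable_snd))
  have hΦ : Measurable fun w : Config N d X => ∫⁻ ηs, H (w, ηs) ∂(lambertNoise d) :=
    hH.lintegral_prod_right'
  have hacc' : ∀ᵐ z ∂L, ∀ᵐ ξs ∂(lambertNoise d), ∃ k, ENNReal.ofReal s < lambertInstant G ε ξs z k :=
    Measure.ae_ae_of_ae_prod hacc
  calc ∫⁻ p, H (lambertFlow G ε p.2 p.1 s, fun n => p.2 (n + lambertCount G ε p.2 p.1 s))
        ∂(L.prod (lambertNoise d))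
      = ∫⁻ z, (∫⁻ ξs, H (lambertFlow G ε ξs z s, fun n => ξs (n + lambertCount G ε ξs z s))
          ∂(lambertNoise d)) ∂L :=
        lintegral_prod _ hR.aemeasurable
    _ = ∫⁻ z, (∫⁻ ξs, (∫⁻ ηs, H (lambertFlow G ε ξs z s, ηs) ∂(lambertNoise d))
          ∂(lambertNoise d)) ∂L :=
        lintegral_congr_ae (hacc'.mono fun z hz => hfresh hH z s hs hz)
    _ = ∫⁻ p, (∫⁻ ηs, H (lambertFlow G ε p.2 p.1 s, ηs) ∂(lambertNoise d))
          ∂(L.prod (lambertNoise d)) :=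
        (lintegral_prod _ (hΦ.comp hmeas).aemeasurable).symm
    _ = ∫⁻ w, (∫⁻ ηs, H (w, ηs) ∂(lambertNoise d))
          ∂(L.prod (lambertNoise d)).map (fun p => lambertFlow G ε p.2 p.1 s) :=
        (lintegral_map hΦ hmeas).symm
    _ = ∫⁻ q, H q ∂(((L.prod (lambertNoise d)).map (fun p => lambertFlow G ε p.2 p.1 s)).prod
          (lambertNoise d)) :=
        (lintegral_prod _ hH.aemeasurable).symm

end Step

/-! ## The torus `𝕋³`: `N + 1` spheres of diameter `hsDiameter σ N`, `0 < σ < 1/2` -/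

/-- **Measurability of the restarted pair** `(z, ξs) ↦ (Λ_s(z; ξs), ξs (· + K_s(z; ξs)))` on `𝕋³`, jointly in
`(z, ξs)`, for `0 ≤ σ < 1/2` (`measurable_lambertFlow_hsDiameter`, `measurable_lambertCount`, and reading a
measurable sequence from a measurable index `…FreshTail.measurable_shift`). [folklore] -/
theorem measurable_lambertRestart : ∀ {σ : ℝ}, 0 ≤ σ → σ < 2⁻¹ → ∀ (N : ℕ) (s : ℝ),
    Measurable fun p : Config (N + 1) (Fin 3) T3 × (ℕ → V3) =>
      (lambertFlow (Torus.geometry (Fin 3)) (hsDiameter σ N) p.2 p.1 s,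
        fun n => p.2 (n + lambertCount (Torus.geometry (Fin 3)) (hsDiameter σ N) p.2 p.1 s)) := by
  intro σ hσ hσ' N s
  have hε' : hsDiameter σ N < 2⁻¹ := (hsDiameter_le hσ N).trans_lt hσ'
  exact (measurable_lambertFlow_hsDiameter hσ hσ' N s).prodMk
    (measurable_shift (measurable_lambertCount (Torus.isHardSphereRegular_geometry hε')
      Torus.isMeasurable_geometry s) measurable_snd)

/-- **Non-accumulation under an absolutely continuous start**: for `0 < σ < 1/2` and `P ≪ liouville` on `𝕋³`,
`P ⊗ γ^ℕ`-a.e. the collision instants of the Lambertian recursion do not accumulate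
(`…SwapGapLiouvilleInvarianceLambda.nonAccumulationLambda` transported along `P ⊗ γ^ℕ ≪ liouville ⊗ γ^ℕ`).
[folklore] -/
theorem ae_nonAccumulation_of_absolutelyContinuous : ∀ {σ : ℝ}, 0 < σ → σ < 2⁻¹ → ∀ (N : ℕ)
    (P : Measure (Config (N + 1) (Fin 3) T3)),
    P ≪ liouville (Torus.geometry (Fin 3)) (N + 1) (hsDiameter σ N) →
    ∀ᵐ p ∂(P.prod (lambertNoise (Fin 3))), ∀ T : ℝ, ∃ k,
      ENNReal.ofReal T < lambertInstant (Torus.geometry (Fin 3)) (hsDiameter σ N) p.2 p.1 k := by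
  intro σ hσ hσ' N P hP
  have hAC : P.prod (lambertNoise (Fin 3)) ≪
      (liouville (Torus.geometry (Fin 3)) (N + 1) (hsDiameter σ N)).prod (lambertNoise (Fin 3)) :=
    hP.prod Measure.AbsolutelyContinuous.rfl
  exact hAC.ae_le (nonAccumulationLambda (hsDiameter σ N) (hsDiameter_pos hσ N)
    ((hsDiameter_le hσ.le N).trans_lt hσ') (N + 1))

/-- **R1. The fresh-tail (strong Markov) identity in law, `lintegral` form** (registered sub-goal
`lintegral_restart_eq` of stmt-11854).  For `0 < σ < 1/2`, a finite initial law `P ≪ liouville` on `𝕋³`, `s ≥ 0`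
and every measurable `H ≥ 0` on (state, noise sequence):
`∫ H(Λ_s(z;ξs), ξs (· + K_s(z;ξs))) d(P ⊗ γ^ℕ)(z, ξs) = ∫ H d(μ_s ⊗ γ^ℕ)`, `μ_s = (P ⊗ γ^ℕ) ∘ Λ_s⁻¹`: the noise not
yet consumed at time `s` is a fresh `γ^ℕ` sequence independent of the state.  Instance of
`lintegral_restart_eq_of_freshTail`: measurability `measurable_lambertFlow_hsDiameter` / `measurable_lambertCount`,
a.e. non-accumulation `ae_nonAccumulation_of_absolutelyContinuous`, pathwise fresh tail
`…FreshTail.lambertFlow_freshTail`. [folklore] -/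
theorem lintegral_restart_eq : ∀ {σ : ℝ}, 0 < σ → σ < 2⁻¹ → ∀ (N : ℕ) (P : Measure (Config (N + 1) (Fin 3) T3))
    [IsFiniteMeasure P], P ≪ liouville (Torus.geometry (Fin 3)) (N + 1) (hsDiameter σ N) → ∀ {s : ℝ}, 0 ≤ s →
    ∀ {H : Config (N + 1) (Fin 3) T3 × (ℕ → V3) → ℝ≥0∞}, Measurable H →
    ∫⁻ p, H (lambertFlow (Torus.geometry (Fin 3)) (hsDiameter σ N) p.2 p.1 s,
        fun n => p.2 (n + lambertCount (Torus.geometry (Fin 3)) (hsDiameter σ N) p.2 p.1 s))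
        ∂(P.prod (lambertNoise (Fin 3))) =
      ∫⁻ q, H q ∂((((P.prod (lambertNoise (Fin 3))).map
        (fun p => lambertFlow (Torus.geometry (Fin 3)) (hsDiameter σ N) p.2 p.1 s))).prod (lambertNoise (Fin 3))) := by
  intro σ hσ hσ' N P _ hP s hs H hH
  have hε' : hsDiameter σ N < 2⁻¹ := (hsDiameter_le hσ.le N).trans_lt hσ'
  have hG : (Torus.geometry (Fin 3)).IsHardSphereRegular (hsDiameter σ N) :=
    Torus.isHardSphereRegular_geometry hε'
  have hGm : (Torus.geometry (Fin 3)).IsMeasurable := Torus.isMeasurable_geometry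
  exact lintegral_restart_eq_of_freshTail P hs (measurable_lambertFlow_hsDiameter hσ.le hσ' N s)
    (measurable_lambertCount hG hGm s)
    ((ae_nonAccumulation_of_absolutelyContinuous hσ hσ' N P hP).mono fun p hp => hp s)
    (fun hH' z t ht hgood => lambertFlow_freshTail hG hGm hH' z t ht hgood) hH

/-- **The law of the restarted pair**: for `0 < σ < 1/2`, an initial law `P ≪ liouville` on `𝕋³` and `s ≥ 0`,
`(P ⊗ γ^ℕ) ∘ restart_s⁻¹ = μ_s ⊗ γ^ℕ` with `restart_s(z, ξs) = (Λ_s(z;ξs), ξs (· + K_s(z;ξs)))` and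
`μ_s = (P ⊗ γ^ℕ) ∘ Λ_s⁻¹` (`Measure.ext_of_lintegral` on R1). [folklore] -/
theorem map_lambertRestart_eq : ∀ {σ : ℝ}, 0 < σ → σ < 2⁻¹ → ∀ (N : ℕ) (P : Measure (Config (N + 1) (Fin 3) T3))
    [IsFiniteMeasure P], P ≪ liouville (Torus.geometry (Fin 3)) (N + 1) (hsDiameter σ N) → ∀ {s : ℝ}, 0 ≤ s →
    (P.prod (lambertNoise (Fin 3))).map (fun p =>
        (lambertFlow (Torus.geometry (Fin 3)) (hsDiameter σ N) p.2 p.1 s,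
          fun n => p.2 (n + lambertCount (Torus.geometry (Fin 3)) (hsDiameter σ N) p.2 p.1 s))) =
      (((P.prod (lambertNoise (Fin 3))).map
        (fun p => lambertFlow (Torus.geometry (Fin 3)) (hsDiameter σ N) p.2 p.1 s))).prod (lambertNoise (Fin 3)) := by
  intro σ hσ hσ' N P _ hP s hs
  refine Measure.ext_of_lintegral _ fun f hf => ?_
  rw [lintegral_map hf (measurable_lambertRestart hσ.le hσ' N s)]
  exact lintegral_restart_eq hσ hσ' N P hP hs hf

/-- **R2. The fresh-tail identity in law, Bochner form** (registered sub-goal `integral_restart_eq` of stmt-11854).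
For `0 < σ < 1/2`, a finite initial law `P ≪ liouville` on `𝕋³`, `s ≥ 0` and every measurable real `H` on
(state, noise sequence): `∫ H(Λ_s(z;ξs), ξs (· + K_s(z;ξs))) d(P ⊗ γ^ℕ)(z, ξs) = ∫ H d(μ_s ⊗ γ^ℕ)`,
`μ_s = (P ⊗ γ^ℕ) ∘ Λ_s⁻¹`.  No boundedness or integrability hypothesis is needed: `integral_map` along the law
identity `map_lambertRestart_eq` (both sides are the junk value `0` together). [folklore] -/
theorem integral_restart_eq : ∀ {σ : ℝ}, 0 < σ → σ < 2⁻¹ → ∀ (N : ℕ) (P : Measure (Config (N + 1) (Fin 3) T3))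
    [IsFiniteMeasure P], P ≪ liouville (Torus.geometry (Fin 3)) (N + 1) (hsDiameter σ N) → ∀ {s : ℝ}, 0 ≤ s →
    ∀ {H : Config (N + 1) (Fin 3) T3 × (ℕ → V3) → ℝ}, Measurable H →
    ∫ p, H (lambertFlow (Torus.geometry (Fin 3)) (hsDiameter σ N) p.2 p.1 s,
        fun n => p.2 (n + lambertCount (Torus.geometry (Fin 3)) (hsDiameter σ N) p.2 p.1 s))
        ∂(P.prod (lambertNoise (Fin 3))) =
      ∫ q, H q ∂((((P.prod (lambertNoise (Fin 3))).map
        (fun p => lambertFlow (Torus.geometry (Fin 3)) (hsDiameter σ N) p.2 p.1 s))).prod (lambertNoise (Fin 3))) := by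
  intro σ hσ hσ' N P _ hP s hs H hH
  rw [← map_lambertRestart_eq hσ hσ' N P hP hs,
    integral_map (measurable_lambertRestart hσ.le hσ' N s).aemeasurable hH.aestronglyMeasurable]

/-- **Integrability of bounded functionals of the restarted pair**: for `0 < σ < 1/2`, a finite law `P` on `𝕋³`,
any `s` and a bounded measurable real `H` on (state, noise sequence), `(z, ξs) ↦ H(Λ_s(z;ξs), ξs (· + K_s(z;ξs)))` is
`P ⊗ γ^ℕ`-integrable (bounded and measurable on a finite measure space). [folklore] -/
theorem integrable_restart : ∀ {σ : ℝ}, 0 < σ → σ < 2⁻¹ → ∀ (N : ℕ) (P : Measure (Config (N + 1) (Fin 3) T3))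
    [IsFiniteMeasure P] (s : ℝ) {H : Config (N + 1) (Fin 3) T3 × (ℕ → V3) → ℝ}, Measurable H →
    ∀ B : ℝ, (∀ q, |H q| ≤ B) →
    Integrable (fun p : Config (N + 1) (Fin 3) T3 × (ℕ → V3) =>
      H (lambertFlow (Torus.geometry (Fin 3)) (hsDiameter σ N) p.2 p.1 s,
        fun n => p.2 (n + lambertCount (Torus.geometry (Fin 3)) (hsDiameter σ N) p.2 p.1 s)))
      (P.prod (lambertNoise (Fin 3))) := by
  intro σ hσ hσ' N P _ s H hH B hB
  exact (integrable_const B).mono' (hH.comp (measurable_lambertRestart hσ.le hσ' N s)).aestronglyMeasurable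
    (ae_of_all _ fun p => by rw [Real.norm_eq_abs]; exact hB _)

/-- **R3. The entropy inequality with restart for bounded functionals** (registered sub-goal
`restart_entropyInequality` of stmt-11854).  For `0 < σ < 1/2`, probability laws `P ≪ liouville` and `R` on `𝕋³`
configurations, a bounded measurable real `H` on (state, noise sequence), `s ≥ 0`, a rate `β > 0` and
`KL(μ_s ‖ R) < ∞` (`μ_s = (P ⊗ γ^ℕ) ∘ Λ_s⁻¹`):
`−∫ H(Λ_s(z;ξs), ξs (· + K_s(z;ξs))) d(P ⊗ γ^ℕ) ≤ β⁻¹ (KL(μ_s ‖ R) + log ∫ e^{−βH} d(R ⊗ γ^ℕ))`.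
Proof: R2, then `…RestartEntropyInequality.integral_prod_noise_ge` at `μ = μ_s` (a probability law,
`isProbabilityMeasure_map`); `H` and `e^{−βH}` are bounded measurable, hence integrable on the probability spaces
(cf. `…WindowEntropyInequality.window_entropyInequality_restart`, the time-integral case; the inequality itself is
Kipnis–Landim 1999, Appendix 1 §8, landed there). [folklore] -/
theorem restart_entropyInequality : ∀ {σ : ℝ}, 0 < σ → σ < 2⁻¹ → ∀ (N : ℕ)
    (P R : Measure (Config (N + 1) (Fin 3) T3)) [IsProbabilityMeasure P] [IsProbabilityMeasure R],
    P ≪ liouville (Torus.geometry (Fin 3)) (N + 1) (hsDiameter σ N) →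
    ∀ (H : Config (N + 1) (Fin 3) T3 × (ℕ → V3) → ℝ), Measurable H → ∀ B : ℝ, (∀ q, |H q| ≤ B) →
    ∀ (s β : ℝ), 0 ≤ s → 0 < β →
    klDiv (((P.prod (lambertNoise (Fin 3))).map
        (fun p => lambertFlow (Torus.geometry (Fin 3)) (hsDiameter σ N) p.2 p.1 s))) R ≠ ⊤ →
    -(∫ p, H (lambertFlow (Torus.geometry (Fin 3)) (hsDiameter σ N) p.2 p.1 s,
        fun n => p.2 (n + lambertCount (Torus.geometry (Fin 3)) (hsDiameter σ N) p.2 p.1 s))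
        ∂(P.prod (lambertNoise (Fin 3)))) ≤
      β⁻¹ * ((klDiv (((P.prod (lambertNoise (Fin 3))).map
          (fun p => lambertFlow (Torus.geometry (Fin 3)) (hsDiameter σ N) p.2 p.1 s))) R).toReal +
        Real.log (∫ q, Real.exp (-(β * H q)) ∂(R.prod (lambertNoise (Fin 3))))) := by
  intro σ hσ hσ' N P R _ _ hP H hH B hB s β hs hβ hfin
  rw [integral_restart_eq hσ hσ' N P hP hs hH]
  haveI : IsProbabilityMeasure (((P.prod (lambertNoise (Fin 3))).map
      (fun p => lambertFlow (Torus.geometry (Fin 3)) (hsDiameter σ N) p.2 p.1 s))) :=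
    Measure.isProbabilityMeasure_map (measurable_lambertFlow_hsDiameter hσ.le hσ' N s).aemeasurable
  have hF : Integrable H ((((P.prod (lambertNoise (Fin 3))).map
      (fun p => lambertFlow (Torus.geometry (Fin 3)) (hsDiameter σ N) p.2 p.1 s))).prod (lambertNoise (Fin 3))) :=
    (integrable_const B).mono' hH.aestronglyMeasurable
      (ae_of_all _ fun q => by rw [Real.norm_eq_abs]; exact hB q)
  have hexp : Integrable (fun q : Config (N + 1) (Fin 3) T3 × (ℕ → V3) => Real.exp (-(β * H q)))
      (R.prod (lambertNoise (Fin 3))) := by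
    refine (integrable_const (Real.exp (β * B))).mono'
      (Real.measurable_exp.comp (hH.const_mul β).neg).aestronglyMeasurable (ae_of_all _ fun q => ?_)
    rw [Real.norm_eq_abs, abs_of_pos (Real.exp_pos _), Real.exp_le_exp]
    have h2 := (abs_le.1 (hB q)).1
    nlinarith [hβ, h2]
  exact integral_prod_noise_ge _ R (lambertNoise (Fin 3)) hfin hβ hF hexp

end Summit.AtomisticToContinuum.HydrodynamicLimit.Theorems.LambertianContactSwapLambertianEulerRestartInLaw

end
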